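import Literature.NumberTheory.EllipticCurves.Kato2004.MemberHullInputsTwoNoSplitTwist
import Literature.NumberTheory.EllipticCurves.Kato2004.MemberHullInputsTwoSharp
import HarnessLib

/-!
# Kato 2004 at `p = 2`, the MEMBER package for REDUCIBLE `E[2]` under (NST′) «no split multiplicative twist by `−1` or `−2`
# at `2`» WITH THE SHARP rank-`0` count (exponent `2·ord₂ #W_K(ℚ)_tors`): the twin of
# `MemberHullInputsTwoNoSplitTwist.lean` exactly as `MemberHullInputsTwoSharp.lean` is the twin of `MemberHullInputsTwo.lean`

Topic `NumberTheory/EllipticCurves`, sub-directory `Kato2004` (namespace = path). Seat `bsd-2adic-k4-w2` GEN 4 (prover, cell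
`bsd-2adic`, rung K4, crux stmt-BirchSwinnertonDyer-19098 `AdditiveRankZeroAtTwo`, children C2″ 22616 / C4″ 22618). ONE named
existence fact (`def … : Prop`, D-0014): the fact `exists_memberHullInputs_two_of_noSplitTwistNegOneNegTwo` (seat
`bsd-2adic-addL2x` GEN 13; reading R1–R13; D-audit hMHnst@2) VERBATIM — hypotheses, quantifiers, witnesses —, with the conclusion
`Nonempty (MemberHullInputs W_K 2 κ γ I 𝐲)` strengthened to `∃ K : MemberHullInputs W_K 2 κ γ I 𝐲` together with the SHARP COUNT
of `MemberHullInputsTwoSharp.lean` (reading step R12♯ there; exponent `2t` instead of the structure field's `3t`). Nothing else.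

## Why R12♯ holds under (NST′) (one paragraph; R13 of `MemberHullInputsTwoNoSplitTwist.lean` + R12♯ of `MemberHullInputsTwoSharp.lean`)

R13 records that among R1–R12 the potentially-good hypothesis is used ONLY in R8 (the local term of Kato's Thm. 12.5 (3) in step
T3), and that «R12 = T7″/T8 is local and torsion-agnostic at an ADDITIVE `2` (`Ẽ_ns = 𝔾_a`)». R12♯ modifies R12 only in its
steps (iv)–(v): the Poitou–Tate sequence for `F₀* ≤ F*` on `W` (Mazur–Rubin Thm. 2.3.4) has last terms `S₂(E/ℚ)^∨ → H¹_F(ℚ,T)^∨ → 0`,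
so Cassels' cokernel is `(S₂(E/ℚ)/H¹_F(ℚ,T))^∨` and, with the factor `#H¹_F(ℚ,T)` of step (ii), contributes `#S₂(E/ℚ) = 2^t` in
total — a statement about GLOBAL duality over `G_Σ`, the size `#S₂(E/ℚ) = 2^t` (rank `0`, `Ш[2^∞]` finite; any reduction type) and
the orders `#(H¹_ur(ℚ_ℓ,W)/H¹_f(ℚ_ℓ,W)) = 2^{v₂(c_ℓ)}` at ODD `ℓ`; the prime `2` enters only through T8's local index
`[H¹_s(ℚ₂,T) : ℤ₂ loc_s y₀] = 2^{e + t₂ − v₂(c₂)}`, valid at every ADDITIVE `2`. Hence R12♯ is reduction-type-free among additive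
curves exactly as R12 is, and the witnesses of R1–R11 (R8 through R13 under (NST′)) satisfy the sharp count. Net consequence through the
tree's proved hull descent: `ord₂ #Ш(W_K)[2^∞] + v₂ Tam(W_K) ≤ ord₂(L(W_K,1)/Ω(W_K)) + 2·ord₂ #W_K(ℚ)_tors` — the BSD-sharp upper half
at the member — for every globally minimal non-CM `W`, ADDITIVE at `2` with (NST′), `W[2]` reducible, `L(W,1) ≠ 0`, `Ш` finite
(consumer: `Summits/BirchSwinnertonDyer/BirchSwinnertonDyer/Theorems/ByReductionTypeAtTwoAdditiveReducibleKatoMemberSharpNST.lean`).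
Potentially good ⟹ (NST′), so this fact IMPLIES `exists_memberHullInputs_two_sharp` (recorded Summits-side), and it implies
`exists_memberHullInputs_two_of_noSplitTwistNegOneNegTwo` (the package inhabits the structure).

WHAT IS NOT CLAIMED. As in `MemberHullInputsTwoNoSplitTwist.lean` and `MemberHullInputsTwoSharp.lean`: nothing for the curves with a
split multiplicative twist by `−1` or `−2` (there R8 carries Kato's local term); statement (A) at `(W_K,2)` displayed, not asserted;
no claim which curve `W_K` is; no equality form; no `_holds` (size XL). No `instance`, no notation. Flag for the referee (a DIFF
audit against hMHnst@2 and the SHARP-COUNT flag): `Kato-12.4-12.6-13.10-13.13-14.14-member-hull-reading-reducible-at-two-noSplitTwistNegOneNegTwo-SHARP-COUNT`.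
Census (context): 61 of the 463 potentially multiplicative X5@2 classes are (NST′) with reducible `E[2]`; on them the consumer's
side conditions «no point of order 4·(odd) in the class ∧ ord₂ #Ш_an even» disappear.

## References

* K. Kato, Astérisque 295 (2004): §8.2, Thm. 12.4 (1)(2), Thm. 12.5 (1)–(3) and (12.5.1), Thm. 12.6, Rem. 12.7, 13.8–13.10,
  13.13–13.14, Thm. 14.5 (1)(2), §14.8, (14.9.1)–(14.9.6), §14.14–Lemma 14.15, Prop. 14.16 (2) and its proof (pp. 180–181,
  221–245) — store text `paper:doi-10-24033-ast-639`, read 2026-08-28. [Kato2004Asterisque]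
* B. Mazur, K. Rubin, Mem. AMS 799 (2004), Thm. 2.3.4; K. Rubin, *Euler Systems*, Ch. I §3–§4, Thm. I.7.3; Ch. II Thm. 2.3. [MazurRubin2004] [Rubin2000]
* R. Greenberg, LNM 1716 (1999), Prop. 4.13; §3 after Lemma 3.3. [GreenbergLNM1716]
* J. H. Silverman, *Advanced Topics*, V.3, Lemma V.5.2, Thm. V.5.3 (Tate curves; split multiplicative twists). [SilvermanATAEC1994]
* M. F. Lim (2017) Thm. 3.5; J. Coates, R. Sujatha (2005), statement (A). [Lim2017FineSelmer] [CoatesSujatha2005]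
* Tree: `Kato2004/MemberHullInputsTwoNoSplitTwist.lean` (R13), `Kato2004/MemberHullInputsTwoSharp.lean` (R12♯),
  `Kato2004/MemberHullInputsTwo.lean` (R1–R12), `Kato2004/AdditiveNoSplitCyclotomicTwistRankZeroShaUpperBoundFineSelmerAtTwoSharp.lean` (T15–T16).
-/

noncomputable section

open scoped NumberField TensorProduct
open Field IsDedekindDomain CongruenceSubgroup
open Literature.NumberTheory.GaloisRepresentations
open Literature.NumberTheory.EllipticCurves Literature.NumberTheory.EllipticCurves.ModularForms
open Literature.NumberTheory.EllipticCurves.Kato2004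
open Literature.NumberTheory.EllipticCurves.Kato2004.EulerSystemValues Rat.HeightOneSpectrum
open Literature.NumberTheory.EllipticCurves.IwasawaAlgebra

namespace Literature.NumberTheory.EllipticCurves.Kato2004

/-- **Kato 2004 at `p = 2`, the member package for REDUCIBLE `E[2]` under (NST′) «no split multiplicative twist by `−1` or `−2`
at `2`», WITH THE SHARP rank-`0` COUNT** — `exists_memberHullInputs_two_of_noSplitTwistNegOneNegTwo` (Kato Thm. 12.4, 12.5 (1)–(3)
with (12.5.1)/13.13 for the local term, 12.6 + 13.10 (1) + 13.14, §14.14, 14.5 (1)(2) at `T = V_{ℤ₂}(f)(1)`; reading R1–R13)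
VERBATIM, its conclusion strengthened to `∃ K : MemberHullInputs W_K 2 κ γ I 𝐲` plus the count with exponent `2·ord₂ #W_K(ℚ)_tors`
(reading step R12♯ of `MemberHullInputsTwoSharp.lean`, reduction-type-free among additive curves: module docstring). For every
globally minimal NON-CM `W/ℚ`, ADDITIVE at `2`, with NO split multiplicative twist by `−1` or `−2` at `2`, `W[2]` REDUCIBLE,
`L(W,1) ≠ 0`, `Ш(W/ℚ)` finite: a globally minimal member `W_K ∼ W` such that, granted (A) at `(W_K,2)` (displayed), for the newform
`f` and every `ι` there are `ZetaBody` witnesses and, for every cyclotomic tower datum and THE lift `𝐲`, a package `K` with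
`ord₂ #Ш(W_K)[2^∞] + v₂(Tam W_K) + ord₂ #(K.A/Λ·K.ι(𝐲̄)) ≤ ord₂(L(W_K,1)/Ω(W_K)) + v₂(K.lam(0)) + ord₂ #(K.H2/X·K.H2) + 2·ord₂ #W_K(ℚ)_tors`.
A CONSTRUCTION fact (D-0014), a READING; never stronger than what R1–R13 + R12♯ give; implies both
`exists_memberHullInputs_two_of_noSplitTwistNegOneNegTwo` and `exists_memberHullInputs_two_sharp` (Summits-side); no `_holds`
(size XL). Flag: `Kato-12.4-12.6-13.10-13.13-14.14-member-hull-reading-reducible-at-two-noSplitTwistNegOneNegTwo-SHARP-COUNT`.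
[cite: Kato2004Asterisque, §8.2 (pp. 180–181), (12.2.1) (p. 220), Thm. 12.4 (1)(2) (p. 221), Thm. 12.5 (1)–(3) and (12.5.1) (pp. 221–222), Thm. 12.6 and Rem. 12.7 (p. 222), 13.8 (pp. 227–229), 13.9 and Lemma 13.10 (1) (pp. 229–230), 13.13–13.14 (pp. 233–234), Thm. 14.5 (1)(2) (pp. 236–237), §14.8 (pp. 238–239), (14.9.1)–(14.9.6) (pp. 239–240), §14.14 and Lemma 14.15 (pp. 243–244), Prop. 14.16 (2) and its proof (pp. 244–245)]
[cite: MazurRubin2004, Thm. 2.3.4] [cite: Rubin2000, Ch. I §3–§4 and Thm. I.7.3; Ch. II Thm. 2.3]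
[cite: GreenbergLNM1716, Prop. 4.13; §3 after Lemma 3.3]
[cite: SilvermanATAEC1994, V.3; Lemma V.5.2; Thm. V.5.3; Exercise 5.10 and 5.11]
[cite: Lim2017FineSelmer, §3 Thm. 3.5] [cite: CoatesSujatha2005, statement (A)]
[cite: SilvermanAEC2009, Prop. III.4.12, Thm. X.4.14] -/
def exists_memberHullInputs_two_sharp_of_noSplitTwistNegOneNegTwo : Prop :=
  ∀ (W : WeierstrassCurve ℚ) [W.IsElliptic] [W.IsGloballyMinimal], ¬ W.HasCM →
    ¬ W.HasGoodReductionAtPrime 2 → ¬ W.HasMultiplicativeReductionAtPrime 2 →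
    (∀ d : ℚ, d = -1 ∨ d = -2 →
      ¬ (W.quadraticTwist d).HasSplitMultiplicativeReductionAtPrime 2) →
    ¬ W.HasIrreducibleModPGaloisRep 2 →
    W.entireLFunction 1 ≠ 0 → Finite W.sha →
    ∃ (W' : WeierstrassCurve ℚ) (_ : W'.IsElliptic) (_ : W'.IsGloballyMinimal),
      WeierstrassCurve.IsIsogenous W W' ∧
      ∀ [ContinuousSMul ℤ_[2] (W'.tateModule 2)] [Module.Free ℤ_[2] (W'.tateModule 2)]
        [Module.Finite ℤ_[2] (W'.tateModule 2)],
      (∀ (κ : ZpExtension ℚ 2), κ.IsCyclotomic →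
        ∃ (γ : absoluteGaloisGroup ℚ) (D : W'.FineSelmerDualData κ γ),
          Module.Finite ℤ_[2] (RestrictScalars ℤ_[2] (IwasawaAlgebra 2) D.X)) →
      ∀ {N : ℕ} [NeZero N] (f : CuspForm (Gamma0 N) 2), IsNewformOf W f →
      ∀ (ι : (m : ℕ) → (CyclotomicField m ℚ →+* ℂ)),
      ∃ (κ' : ℝ) (Λ' : ∀ (k : ℕ) (r : Finset (HeightOneSpectrum (𝓞 ℚ))),
          H1 (tateRep W' 2) (cycSubgroup 2 k r) →ₗ[ℤ_[2]] ℚ_[2] ⊗[ℚ] CyclotomicField (cycLevel 2 k r) ℚ)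
        (c d a : ℤ) (A : ℕ)
        (z : ∀ (k : ℕ) (r : (cyclotomicLevelsRat 2 (badPlaces c d A N)).Ideals),
          H1 (tateRep W' 2) ((cyclotomicLevelsRat 2 (badPlaces c d A N)).level k r.1))
        (x : ∀ (k : ℕ) (r : (cyclotomicLevelsRat 2 (badPlaces c d A N)).Ideals),
          CyclotomicField (cycLevel 2 k r.1) ℚ),
        κ' ≠ 0 ∧ 0 < A ∧ Int.gcd c (6 * 2 * A) = 1 ∧ Int.gcd d (6 * 2 * N) = 1 ∧
        ZetaBody W' 2 f ι κ' Λ' c d a A z x ∧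
        ∀ (κ : ZpExtension ℚ 2) (γ : absoluteGaloisGroup ℚ) (hκ : κ.IsCyclotomic),
          κ.IsTopGenerator γ →
          ∀ (I : IwasawaH1Data W' 2 κ γ) (y : I.H),
            (∀ n : ℕ, I.proj n y = levelToLayerTwo W' hκ (badPlaces c d A N) n
              (z (n + 2) (cyclotomicLevelsRat 2 (badPlaces c d A N)).idealOne)) →
            ∃ K : MemberHullInputs W' 2 κ γ I y,
              ∃ q : ℚ, W'.entireLFunction 1 / (W'.realPeriodRat : ℂ) = (q : ℂ) ∧
                (padicValNat 2 (Nat.card (AddCommGroup.primaryComponent W'.sha 2)) : ℤ) +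
                    padicValNat 2 W'.tamagawaProduct +
                    padicValNat 2 (Nat.card (K.A ⧸ (IwasawaAlgebra 2) ∙ K.ι (Submodule.Quotient.mk y))) ≤
                  padicValRat 2 q + ((PowerSeries.constantCoeff K.lam).valuation : ℤ) +
                    padicValNat 2 (Nat.card (coinvariants 2 K.H2)) +
                    2 * (padicValNat 2 W'.torsionOrder : ℤ)

end Literature.NumberTheory.EllipticCurves.Kato2004

end
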